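import Literature.InformationTheory.QuantumCodes.SpaceTimePolygonExtraction
import Literature.InformationTheory.QuantumCodes.PathCountingBound
import Mathlib.Analysis.SpecificLimits.Basic
import HarnessLib

/-!
# The Dennis–Kitaev–Landahl–Preskill threshold for the toric code with NOISY syndrome
# measurement — proof (`ToricCode.phenomFailureProb_le_of_sawCountBound` and
# `ToricCode.phenomThreshold_of_sawCountBound` discharged)

Topic `Literature/InformationTheory/QuantumCodes` (venture QEC, LADDER-QEC rung Q5, PARTITION row 09
"phenomenological"). Theorem-only file assembling

* `PathCountingBound.lean` — the i.i.d. half-weight bound `(2√(p(1-p)))^ℓ` for a fixed set of `ℓ`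
  links and the union bound over a covering family (DKLP eqs. (e_ineq)–(saw_prob)), applied on
  the space-time links `STLink L T` in the isotropic case `q = p` (`phenomenologicalWeight_self`);
* `SpaceTimePolygons.lean` — self-avoiding polygons of the space-time lattice, the space-time
  cycle they carry, `n_SAP(ℓ) ≤ L²(T+1) · c_{ℓ-1}(ℤ³)`;
* `SpaceTimePolygonExtraction.lean` — failure of minimum-weight space-time decoding yields a
  self-avoiding polygon with `ℓ ≥ L` links at least half of which are faulty;

into the two named facts of `ToricCodePhenomenological.lean` (qec-type-09):

* **`phenomFailureProb_le_of_sawCountBound_holds`** (DKLP eq. (fail_iso) in the tree's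
  constants): for `L ≥ 3`, a minimum-weight space-time decoder, `0 ≤ p ≤ 1/2` and
  `r = 2ν√(p(1-p)) < 1`, under the walk-count bound `cₙ(ℤ³) ≤ C νⁿ`:
  `Prob_fail ≤ Σ_{ℓ ≥ L} n_SAP(ℓ) (4p̃)^{ℓ/2} ≤ Σ_{ℓ ≥ L} L²(T+1) C ν^{ℓ-1} (2√p̃)^ℓ ≤ 2L²(T+1)C r^L/(ν(1-r))`;
* **`phenomThreshold_of_sawCountBound_holds`** (the D4″ parametric threshold theorem, isotropic
  `q = p`): for `4ν² p(1-p) < 1` and polynomially many rounds `T(L)`, the failure probability of the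
  `(L+1) × (L+1)` toric codes monitored for `T(L)` rounds tends to `0`
  (`(L+1)²(T(L)+1) r^{L+1} → 0`).

No new definitions; no named facts; the printed numerical value `.0114` is not asserted anywhere
(it needs the numerical estimate `μ₃ ≈ 4.684`; certified instances by import live Summits-side in
`Summits/Ventures/QEC/Thresholds/ToricCodePhenomenologicalThresholds.lean`).

## References

* [DennisEtAl2002] E. Dennis, A. Kitaev, A. Landahl, J. Preskill, *Topological quantum memory*,
  J. Math. Phys. 43 (2002) 4452–4505, arXiv:quant-ph/0110143, §5.2 eqs. (e_ineq), (saw_prob),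
  (saw_L), §5.3 eqs. (saw_d), (saw_3), (threshold_iso), (fail_iso), (threshold_iso_num).
-/

namespace Literature.InformationTheory.QuantumCodes

namespace ToricCode

open Finset Matrix Filter Topology
open Literature.Probability.RandomPlanarGeometry
open Literature.Probability.RandomPlanarGeometry.SAW.Zd

variable {L T : ℕ}

/-- A non-zero element of `ℤ₂` is `1`. [folklore] -/
private theorem zmod2_eq_one_of_ne_zero' {x : ZMod 2} (h : x ≠ 0) : x = 1 := by
  revert x; decide

/-- A history is determined by its support. [cite: DennisEtAl2002, §4.4 (n_E(ℓ) ∈ {0,1})] -/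
private theorem supp_injective' [NeZero L] : Function.Injective (supp : History L T → Finset (STLink L T)) := by
  intro e₁ e₂ h
  funext ℓ
  have h1 : ℓ ∈ supp e₁ ↔ ℓ ∈ supp e₂ := by rw [h]
  simp only [supp, Finset.mem_filter, Finset.mem_univ, true_and] at h1
  by_cases h0 : e₁ ℓ = 0
  · rw [h0]
    by_contra h2
    exact (h1.2 (Ne.symm h2)) h0
  · rw [zmod2_eq_one_of_ne_zero' h0, zmod2_eq_one_of_ne_zero' (h1.1 h0)]

/-- The walk-count hypothesis bounds the number of self-avoiding step words of `ℤ³`: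
`#sawWords 3 n = cₙ(ℤ³) ≤ C νⁿ`. [cite: DennisEtAl2002, §5.3 eqs. (saw_d), (saw_3)] -/
private theorem card_sawWords_three_le {C ν : ℝ} (h : SAWCountBound3 C ν) (n : ℕ) :
    ((Word.sawWords 3 n).card : ℝ) ≤ C * ν ^ n := by
  rw [Word.card_sawWords]
  exact h n

/-- The walk-count constant is at least `1` (`c₀ = 1`), in particular non-negative.
[cite: DennisEtAl2002, §5.3 eq. (saw_d)] -/
private theorem nonneg_of_sawCountBound3 {C ν : ℝ} (h : SAWCountBound3 C ν) : 0 ≤ C := by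
  have h0 := h 0
  rw [SAW.Zd.count_zero, pow_zero, mul_one, Nat.cast_one] at h0
  linarith

/-- **DKLP's finite-size bound for noisy syndrome measurement, proved**:
`Prob_fail ≤ 2 L²(T+1) C r^L / (ν (1 - r))`, `r = 2ν√(p(1-p))`, in the isotropic case `q = p`.
[cite: DennisEtAl2002, §5.2–5.3 eqs. (saw_prob), (saw_L), (fail_iso)] -/
theorem phenomFailureProb_le_of_sawCountBound_holds : phenomFailureProb_le_of_sawCountBound := by
  intro C ν hν hC L T hNZ hL D hD p hp0 hp hr1
  classical
  set s := Real.sqrt (p * (1 - p)) with hs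
  set r := 2 * ν * s with hr
  have hs0 : 0 ≤ s := Real.sqrt_nonneg _
  have hr0 : 0 ≤ r := by rw [hr]; positivity
  have h1r : 0 < 1 - r := by linarith
  have hC0 : 0 ≤ C := nonneg_of_sawCountBound3 hC
  -- Step 1: the failing error histories, reindexed by their supports; `q = p` is i.i.d. noise
  unfold phenomFailureProb
  set F := univ.filter (fun E : History L T => ¬ D.Corrects (stSyn L T) (stTrivial L T) E) with hF
  have hsum : ∑ E ∈ F, phenomenologicalWeight T p p (supp E) = ∑ S ∈ F.image supp, bernoulliWeight p S := by
    rw [Finset.sum_image fun e₁ _ e₂ _ h => supp_injective' h]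
    exact Finset.sum_congr rfl fun E _ => phenomenologicalWeight_self T p (supp E)
  rw [hsum]
  -- Step 2: the covering family of long self-avoiding polygons of the window
  set Ps : Finset (Finset (STLink L T)) := univ.filter (fun P =>
    (∃ (x : STASite L) (w : List (Fin 3 × Bool)), IsSTPolygon x w ∧
      ↑(stPolygonEdges x w) ⊆ Set.range (stLinkOf : STLink L T → STALink L) ∧
      stLinks (stPolygonEdges x w) = P) ∧ L ≤ P.card) with hPs
  have hcover : ∀ S ∈ F.image supp, ∃ P ∈ Ps,
      ((fun P : Finset (STLink L T) => P) P).card ≤ 2 * ((fun P : Finset (STLink L T) => P) P ∩ S).card := by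
    intro S hS
    obtain ⟨E, hE, rfl⟩ := Finset.mem_image.1 hS
    have hfail : ¬ D.Corrects (stSyn L T) (stTrivial L T) E := (Finset.mem_filter.1 hE).2
    obtain ⟨x, w, hP, hrange, hLw, hhalf⟩ := exists_stPolygon_of_failure hL hD hfail
    refine ⟨stLinks (stPolygonEdges x w), ?_, ?_⟩
    · rw [hPs, Finset.mem_filter]
      refine ⟨Finset.mem_univ _, ⟨x, w, hP, hrange, rfl⟩, ?_⟩
      rw [card_stLinks hrange, hP.card_stPolygonEdges]
      exact hLw
    · simp only
      rw [card_stLinks hrange, hP.card_stPolygonEdges]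
      exact hhalf
  have h1 := sum_bernoulliWeight_le_of_cover hp0 hp Ps (fun P : Finset (STLink L T) => P) (F.image supp) hcover
  -- Step 3: grade the polygons by their number of links `ℓ ∈ [L, #links]`
  set M := Fintype.card (STLink L T) with hM
  have hmaps : ∀ P ∈ Ps, P.card ∈ Finset.Ico L (M + 1) := by
    intro P hP
    rw [hPs, Finset.mem_filter] at hP
    rw [Finset.mem_Ico]
    exact ⟨hP.2.2, Nat.lt_succ_of_le (Finset.card_le_univ P)⟩
  have h2 : ∑ P ∈ Ps, (2 * s) ^ P.card =
      ∑ H ∈ Finset.Ico L (M + 1), ∑ P ∈ Ps.filter (fun P => P.card = H), (2 * s) ^ P.card :=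
    (Finset.sum_fiberwise_of_maps_to hmaps _).symm
  -- Step 4: each fiber has at most `L²(T+1) c_{H-1}(ℤ³) ≤ L²(T+1) C ν^{H-1}` polygons
  have hfiber : ∀ H ∈ Finset.Ico L (M + 1),
      ∑ P ∈ Ps.filter (fun P => P.card = H), (2 * s) ^ P.card ≤
        (L : ℝ) ^ 2 * ((T : ℝ) + 1) * (C * ν ^ (H - 1)) * (2 * s) ^ H := by
    intro H _
    have hcount : ((Ps.filter (fun P => P.card = H)).card : ℝ) ≤ (L : ℝ) ^ 2 * ((T : ℝ) + 1) * (C * ν ^ (H - 1)) := by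
      have hc := card_stPolygons_le hL H (Ps.filter (fun P => P.card = H)) (by
        intro P hP
        rw [Finset.mem_filter, hPs, Finset.mem_filter] at hP
        obtain ⟨⟨-, ⟨x, w, hPw, hrange, rfl⟩, -⟩, hH⟩ := hP
        refine ⟨x, w, hPw, ?_, hrange, rfl⟩
        rw [← hH, card_stLinks hrange, hPw.card_stPolygonEdges])
      calc ((Ps.filter (fun P => P.card = H)).card : ℝ)
          ≤ ((L ^ 2 * (T + 1) * (Word.sawWords 3 (H - 1)).card : ℕ) : ℝ) := by exact_mod_cast hc
        _ = (L : ℝ) ^ 2 * ((T : ℝ) + 1) * ((Word.sawWords 3 (H - 1)).card : ℝ) := by push_cast; ring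
        _ ≤ (L : ℝ) ^ 2 * ((T : ℝ) + 1) * (C * ν ^ (H - 1)) :=
            mul_le_mul_of_nonneg_left (card_sawWords_three_le hC (H - 1)) (by positivity)
    calc ∑ P ∈ Ps.filter (fun P => P.card = H), (2 * s) ^ P.card
        = ∑ P ∈ Ps.filter (fun P => P.card = H), (2 * s) ^ H :=
          Finset.sum_congr rfl fun P hP => by rw [(Finset.mem_filter.1 hP).2]
      _ = ((Ps.filter (fun P => P.card = H)).card : ℝ) * (2 * s) ^ H := by
          rw [Finset.sum_const, nsmul_eq_mul]
      _ ≤ (L : ℝ) ^ 2 * ((T : ℝ) + 1) * (C * ν ^ (H - 1)) * (2 * s) ^ H :=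
          mul_le_mul_of_nonneg_right hcount (pow_nonneg (by positivity) _)
  -- Step 5: the geometric tail
  have hterm : ∀ H ∈ Finset.Ico L (M + 1),
      (L : ℝ) ^ 2 * ((T : ℝ) + 1) * (C * ν ^ (H - 1)) * (2 * s) ^ H =
        (L : ℝ) ^ 2 * ((T : ℝ) + 1) * C / ν * r ^ H := by
    intro H hH
    have hH1 : 1 ≤ H := le_trans (by omega : 1 ≤ L) (Finset.mem_Ico.1 hH).1
    obtain ⟨H', rfl⟩ : ∃ H', H = H' + 1 := ⟨H - 1, by omega⟩
    simp only [Nat.add_sub_cancel, hr]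
    field_simp
    ring
  have h3 : ∑ H ∈ Finset.Ico L (M + 1), (L : ℝ) ^ 2 * ((T : ℝ) + 1) * (C * ν ^ (H - 1)) * (2 * s) ^ H =
      (L : ℝ) ^ 2 * ((T : ℝ) + 1) * C / ν * ∑ H ∈ Finset.Ico L (M + 1), r ^ H := by
    rw [Finset.mul_sum]
    exact Finset.sum_congr rfl hterm
  have hgeom := geom_tail_le hr0 hr1 L (M + 1)
  calc ∑ S ∈ F.image supp, bernoulliWeight p S
      ≤ ∑ P ∈ Ps, (2 * s) ^ P.card := h1
    _ = ∑ H ∈ Finset.Ico L (M + 1), ∑ P ∈ Ps.filter (fun P => P.card = H), (2 * s) ^ P.card := h2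
    _ ≤ ∑ H ∈ Finset.Ico L (M + 1), (L : ℝ) ^ 2 * ((T : ℝ) + 1) * (C * ν ^ (H - 1)) * (2 * s) ^ H :=
        Finset.sum_le_sum hfiber
    _ = (L : ℝ) ^ 2 * ((T : ℝ) + 1) * C / ν * ∑ H ∈ Finset.Ico L (M + 1), r ^ H := h3
    _ ≤ (L : ℝ) ^ 2 * ((T : ℝ) + 1) * C / ν * (r ^ L / (1 - r)) :=
        mul_le_mul_of_nonneg_left hgeom (by positivity)
    _ ≤ 2 * (L : ℝ) ^ 2 * ((T : ℝ) + 1) * C * r ^ L / (ν * (1 - r)) := by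
        have hX : 0 ≤ (L : ℝ) ^ 2 * ((T : ℝ) + 1) * C / ν * (r ^ L / (1 - r)) := by positivity
        have hν0 : ν ≠ 0 := hν.ne'
        have h1r0 : 1 - r ≠ 0 := h1r.ne'
        have he : 2 * (L : ℝ) ^ 2 * ((T : ℝ) + 1) * C * r ^ L / (ν * (1 - r)) =
            2 * ((L : ℝ) ^ 2 * ((T : ℝ) + 1) * C / ν * (r ^ L / (1 - r))) := by
          field_simp
        rw [he]
        linarith

/-- **The D4″ parametric threshold theorem for noisy syndrome measurement, proved** (given the
finite-size bound): for `4ν² p(1-p) < 1` and polynomially many rounds `T(L)`, the failure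
probability of minimum-weight space-time decoding of the `(L+1) × (L+1)` toric codes tends to `0`
("becomes arbitrarily small as `L` gets large (with `T` increasing no faster than a polynomial of
`L`)"). [cite: DennisEtAl2002, §5.3 eqs. (threshold_iso), (fail_iso), (threshold_iso_num)] -/
theorem phenomThreshold_of_sawCountBound_of (hfin : phenomFailureProb_le_of_sawCountBound) :
    phenomThreshold_of_sawCountBound := by
  intro C ν hν hC T hT D hD p hp0 hp h4
  obtain ⟨A, k, hA⟩ := hT
  set s := Real.sqrt (p * (1 - p)) with hs
  set r := 2 * ν * s with hr
  have hs0 : 0 ≤ s := Real.sqrt_nonneg _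
  have hr0 : 0 ≤ r := by rw [hr]; positivity
  have hpp : 0 ≤ p * (1 - p) := mul_nonneg hp0 (by linarith)
  have hC0 : 0 ≤ C := nonneg_of_sawCountBound3 hC
  have hr1 : r < 1 := by
    have hsq : r ^ 2 = 4 * ν ^ 2 * (p * (1 - p)) := by
      rw [hr, mul_pow, mul_pow, hs, Real.sq_sqrt hpp]
      ring
    have h : r ^ 2 < 1 := by rw [hsq]; exact h4
    have := (sq_lt_one_iff_abs_lt_one r).1 h
    rwa [abs_of_nonneg hr0] at this
  have h1r : 0 < 1 - r := by linarith
  -- `T(L) + 1 ≤ (|A| + 1) (L + 1)^k`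
  set B := |A| + 1 with hB
  have hB0 : 0 ≤ B := by rw [hB]; positivity
  have hTB : ∀ L : ℕ, ((T L : ℕ) : ℝ) + 1 ≤ B * (((L + 1 : ℕ) : ℝ)) ^ k := by
    intro L
    have h1 : ((T L : ℕ) : ℝ) ≤ A * ((L : ℝ) + 1) ^ k := hA L
    have h2 : A * ((L : ℝ) + 1) ^ k ≤ |A| * ((L : ℝ) + 1) ^ k :=
      mul_le_mul_of_nonneg_right (le_abs_self A) (by positivity)
    have h3 : (1 : ℝ) ≤ ((L : ℝ) + 1) ^ k := one_le_pow₀ (by linarith [Nat.cast_nonneg (α := ℝ) L])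
    push_cast
    rw [hB]
    nlinarith
  -- the finite-size bound, for `L + 1 ≥ 3`
  have hbound : ∀ L : ℕ, 2 ≤ L →
      phenomFailureProb (L + 1) (T L) (D L) p p ≤
        2 * ((L + 1 : ℕ) : ℝ) ^ 2 * (((T L : ℕ) : ℝ) + 1) * C * r ^ (L + 1) / (ν * (1 - r)) := by
    intro L hL2
    exact hfin C ν hν hC (L + 1) (T L) (by omega) (D L) (hD L) p hp0 hp hr1
  have hbound' : ∀ L : ℕ, 2 ≤ L →
      phenomFailureProb (L + 1) (T L) (D L) p p ≤
        2 * B * C / (ν * (1 - r)) * (((L + 1 : ℕ) : ℝ) ^ (k + 2) * r ^ (L + 1)) := by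
    intro L hL2
    refine (hbound L hL2).trans ?_
    have hX : 0 ≤ 2 * ((L + 1 : ℕ) : ℝ) ^ 2 * C * r ^ (L + 1) / (ν * (1 - r)) := by positivity
    calc 2 * ((L + 1 : ℕ) : ℝ) ^ 2 * (((T L : ℕ) : ℝ) + 1) * C * r ^ (L + 1) / (ν * (1 - r))
        = (((T L : ℕ) : ℝ) + 1) * (2 * ((L + 1 : ℕ) : ℝ) ^ 2 * C * r ^ (L + 1) / (ν * (1 - r))) := by ring
      _ ≤ (B * ((L + 1 : ℕ) : ℝ) ^ k) * (2 * ((L + 1 : ℕ) : ℝ) ^ 2 * C * r ^ (L + 1) / (ν * (1 - r))) :=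
          mul_le_mul_of_nonneg_right (hTB L) hX
      _ = 2 * B * C / (ν * (1 - r)) * (((L + 1 : ℕ) : ℝ) ^ (k + 2) * r ^ (L + 1)) := by ring
  have hnonneg : ∀ L : ℕ, 0 ≤ phenomFailureProb (L + 1) (T L) (D L) p p := by
    intro L
    unfold phenomFailureProb
    refine Finset.sum_nonneg fun E _ => ?_
    rw [phenomenologicalWeight_self]
    exact bernoulliWeight_nonneg hp0 (by linarith) _
  -- the bound tends to zero: `(L+1)^(k+2) r^{L+1} → 0`
  have hlim : Tendsto (fun L : ℕ => 2 * B * C / (ν * (1 - r)) * (((L + 1 : ℕ) : ℝ) ^ (k + 2) * r ^ (L + 1)))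
      atTop (𝓝 0) := by
    have h0 := tendsto_pow_const_mul_const_pow_of_abs_lt_one (k + 2) (show |r| < 1 by rwa [abs_of_nonneg hr0])
    have h1 : Tendsto (fun L : ℕ => ((L + 1 : ℕ) : ℝ) ^ (k + 2) * r ^ (L + 1)) atTop (𝓝 0) :=
      (Filter.tendsto_add_atTop_iff_nat 1).2 h0
    have h2 := h1.const_mul (2 * B * C / (ν * (1 - r)))
    rwa [mul_zero] at h2
  refine squeeze_zero' (Filter.Eventually.of_forall hnonneg) ?_ hlim
  rw [Filter.eventually_atTop]
  exact ⟨2, fun L hL => hbound' L hL⟩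

/-- **`ToricCode.phenomThreshold_of_sawCountBound` holds** — the Dennis–Kitaev–Landahl–Preskill
threshold for the toric code with NOISY syndrome measurement (isotropic `q = p`, minimum-weight
space-time decoding, polynomially many rounds), parametric in the cubic self-avoiding-walk count
bound (director-qec D4″); discharges the named fact of `ToricCodePhenomenological.lean`.
[cite: DennisEtAl2002, §5.2–5.3 eqs. (saw_L), (threshold_iso), (fail_iso), (threshold_iso_num)] -/
theorem phenomThreshold_of_sawCountBound_holds : phenomThreshold_of_sawCountBound :=
  phenomThreshold_of_sawCountBound_of phenomFailureProb_le_of_sawCountBound_holds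

end ToricCode

end Literature.InformationTheory.QuantumCodes
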